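import Literature.AlgebraicGeometry.GroupSchemes.CartierDualBlockReduction
import HarnessLib

/-!
# The ideal-kernel layer map of an equivariant homomorphism: `ψ : A → B` intertwining `O`-actions restricts uniquely to `A[𝔭] → B[𝔭]`
# ([Tate 1997] (1.6)–(1.7); [Mumford 1970] §7 Thm. 4; [Liu 2021] Prop. D.8)

Layer `Literature/AlgebraicGeometry/GroupSchemes`, namespace `Literature.AlgebraicGeometry.GroupSchemes.IdealKernelLayerMap`.  THEOREMS ONLY (no
definition, no named fact, no `instance`, no notation, no `sorry`).  Cell `hodgecm-mathlib` (D-0151), FLOOR 0, P6 «MOD programme» (crux hLiu418 =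
stmt-HodgeConjecture-24832, `--supports`, count-neutral): organ (o1) «IDEAL-KERNEL LAYER MAP OF AN EQUIVARIANT HOMOMORPHISM» dealt by LEAD F0P6-plan (g2)
2026-09-01T20:24:07Z to A-p14 (g33) for the P6a card v9 SUPPLIER ROW `block₀.isogW₀ ∕ isogW₀_hom ∕ isogW₀_ker` (Defs v0.5b :698–:703; P6c binders
`isogW ∕ hisogHom ∕ hisogKer` of `heart_of_carriers`): GEN (`stub_RGD`) defines the special point `quot x̄ H` through a quotient isogeny `ψ : A_x̄ → A_{quot x̄ H}`
that intertwines the `𝒪_F`-actions, and must produce the induced map on the `c•w`-layers `G₀ x̄ = A_x̄[𝔭_{c•w}] → G₀ (quot x̄ H)`, know it is a homomorphism,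
`𝒪_F`-equivariant, and that it kills whatever `ψ` kills.  This file is that restriction, ONCE, for any PINS in the `hkerG₀ ∕ hι₀G ∕ hβ₀G` shape of the datum.
HC_CM is proved only modulo the printed citations until rung 0 closes; nothing here is about HC.

THE MATHEMATICS ([Tate1997FiniteFlatGroupSchemes] (1.6)–(1.7) p. 122: group objects as group functors, homomorphisms as functorial group homomorphisms,
kernels by their exact sequences of `T`-points; [MumfordAV1970] §7 Thm. 4 p. 72: the quotient isogeny of an abelian variety by a finite subgroup — the `ψ`
of the application; [Liu2021] Prop. D.8 (2) p. 135, p. 137: the isogenies between the special fibres read on the `ϖ`-layers).  Work in any cartesian monoidal category `C` (e.g. `Over (Spec k)`).  Let `A`, `B`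
be monoid objects with «actions» `α : O → End A`, `β : O → End B` (bare families of endomorphisms), `𝔭 ⊆ O` any subset (an ideal in the application), and
PINS `ιA : GA ↪ A`, `ιB : GB ↪ B` — mono homomorphisms of monoid objects with the universal property
`(∀ a ∈ 𝔭, t ≫ α a = 1) ↔ (∃ s, s ≫ ιA = t)` for every `T`-point `t` (so `GA = A[𝔭]`, `GB = B[𝔭]` up to unique isomorphism).  Let `ψ : A → B` be a
homomorphism with `α a ≫ ψ = ψ ≫ β a` for `a ∈ 𝔭`.  Then `ιA ≫ ψ` is killed by `𝔭` (`(ιA ≫ ψ) ≫ β a = (ιA ≫ α a) ≫ ψ = 1 ≫ ψ = 1`), so it factors as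
`φ ≫ ιB` for a UNIQUE `φ : GA → GB` (`ιB` mono) — the LAYER MAP.  Everything else is cancellation of the mono `ιB`: `φ` is a homomorphism (`φ ≫ ιB` is);
`φ` intertwines any endomorphisms `uG`, `vG` of the pins lying over endomorphisms `u`, `v` intertwined by `ψ`; a `T`-point `j` of `GA` is killed by `φ` iff
`j ≫ ιA` is killed by `ψ`; `φ(𝟙) = 𝟙`, `φ(ψ ≫ ψ′) = φ(ψ) ≫ φ(ψ′)`, and `φ` of an isomorphism is an isomorphism.

* §1 (generic, `C` cartesian monoidal) `comp_eq_one_of_pin` (the pin is killed by `𝔭`), `pin_comp_comp_eq_one` (`ιA ≫ ψ` is killed by `𝔭`),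
  **`exists_comp_eq`** ∕ `eq_of_comp_eq_of_comp_eq` ∕ **`existsUnique_comp_eq`** (L1), **`isMonHom_of_comp_eq`** (L2), **`comp_eq_comp_of_comp_eq`** (L3:
  equivariance), **`comp_eq_one_iff_of_comp_eq`** ∕ `comp_eq_one_of_comp_eq` (L4: kills), `id_comp_eq`, `comp_comp_eq`, `eq_id_of_comp_eq`,
  `comp_eq_id_of_comp_eq`, **`isIso_of_comp_eq`** (L5: functoriality), and the one-`obtain` package **`exists_layerMap`**.
* §2 (schemes over a field, the datum՚s literal shape: `IsClosedImmersion ι.left` instead of `Mono ι`) **`exists_layerMap_of_isClosedImmersion`**.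

## References
* [Tate1997FiniteFlatGroupSchemes] J. Tate, *Finite flat group schemes*, in: Modular Forms and Fermat՚s Last Theorem (1997), (1.6)–(1.7) p. 122.
* [MumfordAV1970] D. Mumford, *Abelian Varieties* (1970), §7 Thm. 4 p. 72.
* [Liu2021] Y. Liu, *Fourier–Jacobi cycles and arithmetic relative trace formula*, Camb. J. Math. 9 (2021), Prop. D.8 (2) p. 135, p. 137.
-/

set_option autoImplicit false

universe u

open CategoryTheory CategoryTheory.Limits MonoidalCategory CartesianMonoidalCategory AlgebraicGeometry

noncomputable section

namespace Literature.AlgebraicGeometry.GroupSchemes.IdealKernelLayerMap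

open scoped MonObj

/-! ## §0 Over a mono: uniqueness, equivariance, functoriality (any category) -/

section Mono

variable {C : Type*} [Category C]

/-- **(L1) UNIQUENESS**: two morphisms over `ιA ≫ ψ` through the mono `ιB` are equal. [cite: Tate1997FiniteFlatGroupSchemes, (1.6)–(1.7) p. 122] -/
theorem eq_of_comp_eq_of_comp_eq {A B GA GB : C} (ιA : GA ⟶ A) (ιB : GB ⟶ B) [Mono ιB] (ψ : A ⟶ B)
    {φ₁ φ₂ : GA ⟶ GB} (h₁ : φ₁ ≫ ιB = ιA ≫ ψ) (h₂ : φ₂ ≫ ιB = ιA ≫ ψ) : φ₁ = φ₂ := by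
  rw [← cancel_mono ιB, h₁, h₂]

/-- **(L3) EQUIVARIANCE**: endomorphisms `uG` of `GA` over `u` (`uG ≫ ιA = ιA ≫ u`) and `vG` of `GB` over `v`, with `u ≫ ψ = ψ ≫ v`, are intertwined by
the layer map: `uG ≫ φ = φ ≫ vG` (in the application `u = ι_A(a)`, `v = ι_B(a)`, `uG = β₀ a`). [cite: MumfordAV1970, §7 Thm. 4 p. 72] [cite: Liu2021, Prop. D.8 (2) p. 135, p. 137] -/
theorem comp_eq_comp_of_comp_eq {A B GA GB : C} (ιA : GA ⟶ A) (ιB : GB ⟶ B) [Mono ιB] (ψ : A ⟶ B)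
    {φ : GA ⟶ GB} (hφ : φ ≫ ιB = ιA ≫ ψ) {u : A ⟶ A} {v : B ⟶ B} (huv : u ≫ ψ = ψ ≫ v)
    {uG : GA ⟶ GA} (hu : uG ≫ ιA = ιA ≫ u) {vG : GB ⟶ GB} (hv : vG ≫ ιB = ιB ≫ v) :
    uG ≫ φ = φ ≫ vG := by
  rw [← cancel_mono ιB, Category.assoc, hφ, ← Category.assoc, hu, Category.assoc, huv, ← Category.assoc, ← hφ,
    Category.assoc, ← hv, Category.assoc]

/-- **(L5) FUNCTORIALITY, identity**: `𝟙 GA` is the layer map of `𝟙 A`. [cite: Tate1997FiniteFlatGroupSchemes, (1.6)–(1.7) p. 122] -/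
theorem id_comp_eq {A GA : C} (ιA : GA ⟶ A) : 𝟙 GA ≫ ιA = ιA ≫ 𝟙 A := by
  rw [Category.id_comp, Category.comp_id]

/-- **(L5) FUNCTORIALITY, composition**: layer maps compose over composites. [cite: Tate1997FiniteFlatGroupSchemes, (1.6)–(1.7) p. 122] [cite: Liu2021, Prop. D.8 (2) p. 135] -/
theorem comp_comp_eq {A B D GA GB GD : C} (ιA : GA ⟶ A) (ιB : GB ⟶ B) (ιD : GD ⟶ D) {ψ : A ⟶ B} {ψ' : B ⟶ D}
    {φ : GA ⟶ GB} (hφ : φ ≫ ιB = ιA ≫ ψ) {φ' : GB ⟶ GD} (hφ' : φ' ≫ ιD = ιB ≫ ψ') :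
    (φ ≫ φ') ≫ ιD = ιA ≫ ψ ≫ ψ' := by
  rw [Category.assoc, hφ', ← Category.assoc, hφ, Category.assoc]

/-- **(L5)** a layer map of `𝟙 A` on one pin is `𝟙`. [cite: Tate1997FiniteFlatGroupSchemes, (1.6)–(1.7) p. 122] -/
theorem eq_id_of_comp_eq {A GA : C} (ιA : GA ⟶ A) [Mono ιA] {φ : GA ⟶ GA} (hφ : φ ≫ ιA = ιA ≫ 𝟙 A) : φ = 𝟙 GA :=
  eq_of_comp_eq_of_comp_eq ιA ιA (𝟙 A) hφ (id_comp_eq ιA)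

/-- **(L5)** layer maps of mutually inverse morphisms are mutually inverse. [cite: Tate1997FiniteFlatGroupSchemes, (1.6)–(1.7) p. 122] -/
theorem comp_eq_id_of_comp_eq {A B GA GB : C} (ιA : GA ⟶ A) [Mono ιA] (ιB : GB ⟶ B) {ψ : A ⟶ B} {ψ' : B ⟶ A} (hψψ' : ψ ≫ ψ' = 𝟙 A)
    {φ : GA ⟶ GB} (hφ : φ ≫ ιB = ιA ≫ ψ) {φ' : GB ⟶ GA} (hφ' : φ' ≫ ιA = ιB ≫ ψ') : φ ≫ φ' = 𝟙 GA :=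
  eq_id_of_comp_eq ιA (by rw [comp_comp_eq ιA ιB ιA hφ hφ', hψψ'])

/-- **(L5) the layer map of an ISOMORPHISM is an isomorphism** (its inverse is the layer map of the inverse). [cite: Tate1997FiniteFlatGroupSchemes, (1.6)–(1.7) p. 122] -/
theorem isIso_of_comp_eq {A B GA GB : C} (ιA : GA ⟶ A) [Mono ιA] (ιB : GB ⟶ B) [Mono ιB] (ψ : A ≅ B)
    {φ : GA ⟶ GB} (hφ : φ ≫ ιB = ιA ≫ ψ.hom) {φ' : GB ⟶ GA} (hφ' : φ' ≫ ιA = ιB ≫ ψ.inv) : IsIso φ :=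
  ⟨φ', comp_eq_id_of_comp_eq ιA ιB ψ.hom_inv_id hφ hφ', comp_eq_id_of_comp_eq ιB ιA ψ.inv_hom_id hφ' hφ⟩

end Mono

/-! ## §1 The layer map in a cartesian monoidal category -/

section Generic

variable {C : Type*} [Category C] [CartesianMonoidalCategory C]
variable {O : Type*} {σ : Type*} [SetLike σ O]

/-- **The pin is killed by `𝔭`**: if `(∀ a ∈ 𝔭, t ≫ α a = 1) ↔ (∃ s, s ≫ ιA = t)` for all `T`-points, then `ιA ≫ α a = 1` for `a ∈ 𝔭` (take `t := ιA`,
`s := 𝟙`). [cite: Tate1997FiniteFlatGroupSchemes, (1.6)–(1.7) p. 122] -/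
theorem comp_eq_one_of_pin {A GA : C} [MonObj A] (𝔭 : σ) (α : O → (A ⟶ A)) (ιA : GA ⟶ A)
    (hkerA : ∀ ⦃T : C⦄ (t : T ⟶ A), (∀ a ∈ 𝔭, t ≫ α a = 1) ↔ ∃ s : T ⟶ GA, s ≫ ιA = t)
    {a : O} (ha : a ∈ 𝔭) : ιA ≫ α a = 1 :=
  (hkerA ιA).mpr ⟨𝟙 GA, Category.id_comp _⟩ a ha

/-- **`ιA ≫ ψ` is killed by `𝔭`** when `ψ` is a homomorphism intertwining `α a` and `β a` for `a ∈ 𝔭`: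
`ιA ≫ ψ ≫ β a = (ιA ≫ α a) ≫ ψ = 1`. [cite: MumfordAV1970, §7 Thm. 4 p. 72] [cite: Liu2021, Prop. D.8 (2) p. 135] -/
theorem pin_comp_comp_eq_one {A B GA : C} [MonObj A] [MonObj B] (𝔭 : σ) (α : O → (A ⟶ A)) (β : O → (B ⟶ B)) (ιA : GA ⟶ A)
    (hkerA : ∀ ⦃T : C⦄ (t : T ⟶ A), (∀ a ∈ 𝔭, t ≫ α a = 1) ↔ ∃ s : T ⟶ GA, s ≫ ιA = t)
    (ψ : A ⟶ B) [IsMonHom ψ] (hψ : ∀ a ∈ 𝔭, α a ≫ ψ = ψ ≫ β a) {a : O} (ha : a ∈ 𝔭) :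
    (ιA ≫ ψ) ≫ β a = 1 := by
  rw [Category.assoc, ← hψ a ha, ← Category.assoc, comp_eq_one_of_pin 𝔭 α ιA hkerA ha, MonObj.one_comp]

/-- **(L1) EXISTENCE OF THE LAYER MAP**: `ιA ≫ ψ` factors through the pin `ιB : B[𝔭] ↪ B`. [cite: Tate1997FiniteFlatGroupSchemes, (1.6)–(1.7) p. 122]
[cite: Liu2021, Prop. D.8 (2) p. 135, p. 137] -/
theorem exists_comp_eq {A B GA GB : C} [MonObj A] [MonObj B] (𝔭 : σ) (α : O → (A ⟶ A)) (β : O → (B ⟶ B))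
    (ιA : GA ⟶ A) (ιB : GB ⟶ B)
    (hkerA : ∀ ⦃T : C⦄ (t : T ⟶ A), (∀ a ∈ 𝔭, t ≫ α a = 1) ↔ ∃ s : T ⟶ GA, s ≫ ιA = t)
    (hkerB : ∀ ⦃T : C⦄ (t : T ⟶ B), (∀ a ∈ 𝔭, t ≫ β a = 1) ↔ ∃ s : T ⟶ GB, s ≫ ιB = t)
    (ψ : A ⟶ B) [IsMonHom ψ] (hψ : ∀ a ∈ 𝔭, α a ≫ ψ = ψ ≫ β a) :
    ∃ φ : GA ⟶ GB, φ ≫ ιB = ιA ≫ ψ :=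
  (hkerB (ιA ≫ ψ)).mp fun _ ha => pin_comp_comp_eq_one 𝔭 α β ιA hkerA ψ hψ ha

/-- **(L1) THE LAYER MAP EXISTS UNIQUELY.** [cite: Tate1997FiniteFlatGroupSchemes, (1.6)–(1.7) p. 122] [cite: Liu2021, Prop. D.8 (2) p. 135, p. 137] -/
theorem existsUnique_comp_eq {A B GA GB : C} [MonObj A] [MonObj B] (𝔭 : σ) (α : O → (A ⟶ A)) (β : O → (B ⟶ B))
    (ιA : GA ⟶ A) (ιB : GB ⟶ B) [Mono ιB]
    (hkerA : ∀ ⦃T : C⦄ (t : T ⟶ A), (∀ a ∈ 𝔭, t ≫ α a = 1) ↔ ∃ s : T ⟶ GA, s ≫ ιA = t)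
    (hkerB : ∀ ⦃T : C⦄ (t : T ⟶ B), (∀ a ∈ 𝔭, t ≫ β a = 1) ↔ ∃ s : T ⟶ GB, s ≫ ιB = t)
    (ψ : A ⟶ B) [IsMonHom ψ] (hψ : ∀ a ∈ 𝔭, α a ≫ ψ = ψ ≫ β a) :
    ∃! φ : GA ⟶ GB, φ ≫ ιB = ιA ≫ ψ := by
  obtain ⟨φ, hφ⟩ := exists_comp_eq 𝔭 α β ιA ιB hkerA hkerB ψ hψ
  exact ⟨φ, hφ, fun φ' hφ' => eq_of_comp_eq_of_comp_eq ιA ιB ψ hφ' hφ⟩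

/-- **(L2) THE LAYER MAP IS A HOMOMORPHISM**: `φ ≫ ιB = ιA ≫ ψ` is one and `ιB` is a mono homomorphism (★ `AffineGroupScheme.isMonHom_of_comp_mono`).
[cite: Tate1997FiniteFlatGroupSchemes, (1.6)–(1.7) p. 122] -/
theorem isMonHom_of_comp_eq {A B GA GB : C} [MonObj A] [MonObj B] [MonObj GA] [MonObj GB] (ιA : GA ⟶ A) (ιB : GB ⟶ B)
    [IsMonHom ιA] [IsMonHom ιB] [Mono ιB] (ψ : A ⟶ B) [IsMonHom ψ] {φ : GA ⟶ GB} (hφ : φ ≫ ιB = ιA ≫ ψ) : IsMonHom φ :=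
  haveI : IsMonHom (φ ≫ ιB) := hφ ▸ inferInstance
  AffineGroupScheme.isMonHom_of_comp_mono φ ιB

/-- **(L4) WHAT THE LAYER MAP KILLS**: a `T`-point `j` of `GA` is killed by `φ` iff `j ≫ ιA` is killed by `ψ`. [cite: Tate1997FiniteFlatGroupSchemes, (1.6)–(1.7) p. 122]
[cite: Liu2021, Prop. D.8 (2) p. 135, p. 137] -/
theorem comp_eq_one_iff_of_comp_eq {A B GA GB : C} [MonObj B] [MonObj GB] (ιA : GA ⟶ A) (ιB : GB ⟶ B) [IsMonHom ιB] [Mono ιB]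
    (ψ : A ⟶ B) {φ : GA ⟶ GB} (hφ : φ ≫ ιB = ιA ≫ ψ) {T : C} (j : T ⟶ GA) :
    j ≫ φ = 1 ↔ j ≫ ιA ≫ ψ = 1 := by
  rw [← hφ, ← Category.assoc]
  constructor
  · intro h
    rw [h, MonObj.one_comp]
  · intro h
    rw [← cancel_mono ιB, h, MonObj.one_comp]

/-- **(L4) THE LAYER MAP KILLS WHAT `ψ` KILLS**: `j ≫ ιA ≫ ψ = 1 → j ≫ φ = 1` (so `quotIncl (G₀ x̄) I ≫ isogW₀ = 1` once `ψ` kills the closed subgroup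
`V(I) ≤ G₀ x̄ ↪ A_x̄`). [cite: Liu2021, Prop. D.8 (2) p. 135, p. 137] -/
theorem comp_eq_one_of_comp_eq {A B GA GB : C} [MonObj B] [MonObj GB] (ιA : GA ⟶ A) (ιB : GB ⟶ B) [IsMonHom ιB] [Mono ιB]
    (ψ : A ⟶ B) {φ : GA ⟶ GB} (hφ : φ ≫ ιB = ιA ≫ ψ) {T : C} (j : T ⟶ GA) (h : j ≫ ιA ≫ ψ = 1) : j ≫ φ = 1 :=
  (comp_eq_one_iff_of_comp_eq ιA ιB ψ hφ j).mpr h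

/-- **THE LAYER-MAP PACKAGE (one `obtain`)**: for PINS `ιA : A[𝔭] ↪ A`, `ιB : B[𝔭] ↪ B` (mono homomorphisms with the kernel-of-`𝔭` universal property),
actions-on-the-pins `βA`, `βB` over `α`, `β` (`βA a ≫ ιA = ιA ≫ α a`), and a homomorphism `ψ : A → B` with `α a ≫ ψ = ψ ≫ β a` for ALL `a`, there is
`φ : A[𝔭] → B[𝔭]` with: `φ ≫ ιB = ιA ≫ ψ`; `φ` a homomorphism; `βA a ≫ φ = φ ≫ βB a`; `j ≫ φ = 1 ↔ j ≫ ιA ≫ ψ = 1` for every `T`-point `j`; and `φ` is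
unique over `ιA ≫ ψ`. [cite: Tate1997FiniteFlatGroupSchemes, (1.6)–(1.7) p. 122] [cite: MumfordAV1970, §7 Thm. 4 p. 72] [cite: Liu2021, Prop. D.8 (2) p. 135, p. 137] -/
theorem exists_layerMap {A B GA GB : C} [MonObj A] [MonObj B] [MonObj GA] [MonObj GB] (𝔭 : σ) (α : O → (A ⟶ A)) (β : O → (B ⟶ B))
    (ιA : GA ⟶ A) (ιB : GB ⟶ B) [IsMonHom ιA] [IsMonHom ιB] [Mono ιB]
    (hkerA : ∀ ⦃T : C⦄ (t : T ⟶ A), (∀ a ∈ 𝔭, t ≫ α a = 1) ↔ ∃ s : T ⟶ GA, s ≫ ιA = t)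
    (hkerB : ∀ ⦃T : C⦄ (t : T ⟶ B), (∀ a ∈ 𝔭, t ≫ β a = 1) ↔ ∃ s : T ⟶ GB, s ≫ ιB = t)
    (βA : O → (GA ⟶ GA)) (hβA : ∀ a, βA a ≫ ιA = ιA ≫ α a) (βB : O → (GB ⟶ GB)) (hβB : ∀ a, βB a ≫ ιB = ιB ≫ β a)
    (ψ : A ⟶ B) [IsMonHom ψ] (hψ : ∀ a, α a ≫ ψ = ψ ≫ β a) :
    ∃ φ : GA ⟶ GB, φ ≫ ιB = ιA ≫ ψ ∧ IsMonHom φ ∧ (∀ a, βA a ≫ φ = φ ≫ βB a) ∧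
      (∀ ⦃T : C⦄ (j : T ⟶ GA), j ≫ φ = 1 ↔ j ≫ ιA ≫ ψ = 1) ∧ ∀ φ' : GA ⟶ GB, φ' ≫ ιB = ιA ≫ ψ → φ' = φ := by
  obtain ⟨φ, hφ⟩ := exists_comp_eq 𝔭 α β ιA ιB hkerA hkerB ψ fun a _ => hψ a
  exact ⟨φ, hφ, isMonHom_of_comp_eq ιA ιB ψ hφ, fun a => comp_eq_comp_of_comp_eq ιA ιB ψ hφ (hψ a) (hβA a) (hβB a),
    fun T j => comp_eq_one_iff_of_comp_eq ιA ιB ψ hφ j, fun φ' hφ' => eq_of_comp_eq_of_comp_eq ιA ιB ψ hφ' hφ⟩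

end Generic

/-! ## §2 Schemes over a field: the datum՚s literal pin shape (`IsClosedImmersion ι.left`) -/

section Scheme

variable {k : Type u} [Field k] {O : Type*} {σ : Type*} [SetLike σ O]

/-- **THE LAYER-MAP PACKAGE OVER A FIELD, datum shape**: as `exists_layerMap`, with the pins given as homomorphic CLOSED IMMERSIONS `ιA.left`, `ιB.left`
(the `hι₀G` shape of the moduli datum; a closed immersion is a monomorphism of `k`-schemes). [cite: Tate1997FiniteFlatGroupSchemes, (1.6)–(1.7) p. 122]
[cite: MumfordAV1970, §7 Thm. 4 p. 72] [cite: Liu2021, Prop. D.8 (2) p. 135, p. 137] -/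
theorem exists_layerMap_of_isClosedImmersion {A B GA GB : Over (Spec (.of k))} [MonObj A] [MonObj B] [MonObj GA] [MonObj GB]
    (𝔭 : σ) (α : O → (A ⟶ A)) (β : O → (B ⟶ B)) (ιA : GA ⟶ A) (ιB : GB ⟶ B)
    (hιA : IsMonHom ιA ∧ IsClosedImmersion ιA.left) (hιB : IsMonHom ιB ∧ IsClosedImmersion ιB.left)
    (hkerA : ∀ ⦃T : Over (Spec (.of k))⦄ (t : T ⟶ A), (∀ a ∈ 𝔭, t ≫ α a = 1) ↔ ∃ s : T ⟶ GA, s ≫ ιA = t)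
    (hkerB : ∀ ⦃T : Over (Spec (.of k))⦄ (t : T ⟶ B), (∀ a ∈ 𝔭, t ≫ β a = 1) ↔ ∃ s : T ⟶ GB, s ≫ ιB = t)
    (βA : O → (GA ⟶ GA)) (hβA : ∀ a, βA a ≫ ιA = ιA ≫ α a) (βB : O → (GB ⟶ GB)) (hβB : ∀ a, βB a ≫ ιB = ιB ≫ β a)
    (ψ : A ⟶ B) [IsMonHom ψ] (hψ : ∀ a, α a ≫ ψ = ψ ≫ β a) :
    ∃ φ : GA ⟶ GB, φ ≫ ιB = ιA ≫ ψ ∧ IsMonHom φ ∧ (∀ a, βA a ≫ φ = φ ≫ βB a) ∧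
      (∀ ⦃T : Over (Spec (.of k))⦄ (j : T ⟶ GA), j ≫ φ = 1 ↔ j ≫ ιA ≫ ψ = 1) ∧ ∀ φ' : GA ⟶ GB, φ' ≫ ιB = ιA ≫ ψ → φ' = φ := by
  haveI := hιA.1
  haveI := hιB.1
  haveI : IsClosedImmersion ιB.left := hιB.2
  haveI : Mono ιB := Over.mono_of_mono_left ιB
  exact exists_layerMap 𝔭 α β ιA ιB hkerA hkerB βA hβA βB hβB ψ hψ

end Scheme

end Literature.AlgebraicGeometry.GroupSchemes.IdealKernelLayerMap

end
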